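import Summits.HubbardSuperconductivity.HubbardSuperconductivity.Theses.ThermalWedge
import Literature.MathematicalPhysics.QuantumLattice.LiebFluxPhaseProofs
import Literature.MathematicalPhysics.QuantumLattice.DWaveSourceProofs

/-!
# Obstruction templates for crux `TwSeededEnsembleEquivalence` (stmt-HubbardSuperconductivity-1698)

Negative-side support lemmas (refuter, cdisprove gen 2), all sorry-free:

* `seeded_sector_rayleigh_lower_bound` — the trivial half of the one-point Legendre inequality,
  pointwise: `β (μ N − Re⟨ψ, H_L(U,g) ψ⟩) ≤ log Re Z(β, H_L(U,g) − μ N̂)` for every unit `N`-particle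
  `ψ` (`exp_neg_mul_groundEnergy_le_partitionFn` + `Matrix.groundEnergy_le_rayleigh_holds`).
* `twSeededEnsembleEquivalence_midpointConvexT0` — TEMPLATE A: the crux implies T = 0 midpoint
  convexity of the seeded sector energies at `N_L = 2⌊(1−δ)L²/2⌋₊` at scale `L²` (β, μ eliminated).
* `twSeededEnsembleEquivalence_false_of_midpointDefect` — its kill form (`¬ crux` from a defect).
* `twSeededEnsembleEquivalence_slopeWindowT0` — TEMPLATE B: the crux pins the T = 0 chemical
  potential window: backward secant slopes `≤ μ₂ < 0`, forward `≥ μ₁ > −4`.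

See `Cruxes/TwSeededEnsembleEquivalence/Disproof.lean` for the analysis these serve.
-/

namespace Summit.HubbardSuperconductivity.HubbardSuperconductivity.Theorems.TwSeededEnsembleEquivalence.Negative

open Matrix Literature.MathematicalPhysics.QuantumLattice
open Summit.HubbardSuperconductivity.HubbardSuperconductivity.Theses.ThermalWedge
open scoped ComplexOrder

noncomputable section

/-- **Single-vector partition bound.** For Hermitian `A`, `β ≥ 0` and a unit vector `ψ`:
`−β Re⟨ψ, Aψ⟩ ≤ log Re Z(β, A)` (keep the ground-state term of `Z = Σ e^{−βλᵢ}` and use the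
variational principle `E₀ ≤ Re⟨ψ,Aψ⟩`). [folklore] -/
theorem neg_mul_rayleigh_le_log_partitionFn {m : Type*} [Fintype m] [DecidableEq m] [Nonempty m]
    {A : Matrix m m ℂ} (hA : A.IsHermitian) {β : ℝ} (hβ : 0 ≤ β) (ψ : m → ℂ)
    (hψ : star ψ ⬝ᵥ ψ = 1) :
    -(β * (star ψ ⬝ᵥ A *ᵥ ψ).re) ≤ Real.log (A.partitionFn β).re := by
  have h1 : Real.exp (-(β * A.groundEnergy)) ≤ (A.partitionFn β).re :=
    exp_neg_mul_groundEnergy_le_partitionFn hA β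
  have h2 : A.groundEnergy ≤ (star ψ ⬝ᵥ A *ᵥ ψ).re := groundEnergy_le_rayleigh_holds hA ψ hψ
  have h3 : Real.exp (-(β * (star ψ ⬝ᵥ A *ᵥ ψ).re)) ≤ (A.partitionFn β).re :=
    (Real.exp_le_exp.2 (by nlinarith)).trans h1
  calc -(β * (star ψ ⬝ᵥ A *ᵥ ψ).re)
      = Real.log (Real.exp (-(β * (star ψ ⬝ᵥ A *ᵥ ψ).re))) := (Real.log_exp _).symm
    _ ≤ Real.log (A.partitionFn β).re := Real.log_le_log (Real.exp_pos _) h3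

/-- The d-wave seed `P = Δᴴ Δ` is Hermitian. -/
theorem isHermitian_seed (L : ℕ) [NeZero L] :
    ((pairField dWaveFormFactor L)ᴴ * pairField dWaveFormFactor L).IsHermitian :=
  (pairField_conjTranspose_mul_self_posSemidef dWaveFormFactor L).isHermitian

/-- A real multiple of the seed is Hermitian. -/
theorem isHermitian_smul_seed (L : ℕ) [NeZero L] (c : ℝ) :
    ((c : ℂ) • ((pairField dWaveFormFactor L)ᴴ * pairField dWaveFormFactor L)).IsHermitian :=
  (isHermitian_seed L).smul (by rw [isSelfAdjoint_iff, Complex.star_def, Complex.conj_ofReal])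

/-- The grand-canonical seeded Hamiltonian is Hermitian. -/
theorem isHermitian_seededGC (L : ℕ) [NeZero L] (U μ g : ℝ) :
    (hubbardTorusWith 2 L 1 U μ - ((g / (L : ℝ) ^ 2 : ℝ) : ℂ) •
      ((pairField dWaveFormFactor L)ᴴ * pairField dWaveFormFactor L)).IsHermitian :=
  (isHermitian_hubbardTorusWith L 1 U μ).sub (isHermitian_smul_seed L _)

/-- On a unit `N`-particle vector, `Re⟨ψ, (H_g − μN̂) ψ⟩ = Re⟨ψ, H_g ψ⟩ − μN`. -/
theorem re_rayleigh_seededGC (L : ℕ) [NeZero L] (U μ g : ℝ) {N : ℕ}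
    {ψ : Fock (Orb (FermionTorus 2 L))} (hN : IsNParticle N ψ) (hψ : star ψ ⬝ᵥ ψ = 1) :
    (star ψ ⬝ᵥ (hubbardTorusWith 2 L 1 U μ - ((g / (L : ℝ) ^ 2 : ℝ) : ℂ) •
      ((pairField dWaveFormFactor L)ᴴ * pairField dWaveFormFactor L)) *ᵥ ψ).re =
      (star ψ ⬝ᵥ (hubbardTorus 2 L 1 U - ((g / (L : ℝ) ^ 2 : ℝ) : ℂ) •
        ((pairField dWaveFormFactor L)ᴴ * pairField dWaveFormFactor L)) *ᵥ ψ).re - μ * N := by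
  have heq : hubbardTorusWith 2 L 1 U μ - ((g / (L : ℝ) ^ 2 : ℝ) : ℂ) •
      ((pairField dWaveFormFactor L)ᴴ * pairField dWaveFormFactor L) =
      (hubbardTorus 2 L 1 U - ((g / (L : ℝ) ^ 2 : ℝ) : ℂ) •
        ((pairField dWaveFormFactor L)ᴴ * pairField dWaveFormFactor L)) - (μ : ℂ) • totalNumber := by
    rw [hubbardTorusWith_eq]; abel
  rw [heq, sub_mulVec, smul_mulVec, totalNumber_mulVec_of_isNParticle hN, smul_smul,
    dotProduct_sub, dotProduct_smul, hψ, Complex.sub_re]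
  simp

/-- **Sector lower bound (the trivial half, pointwise).** For every unit `N`-particle vector `ψ`,
every `μ` and every `β ≥ 0`: `β (μ N − Re⟨ψ, H_L(U,g) ψ⟩) ≤ log Re Z(β, H_L(U,g) − μN̂)`. [folklore] -/
theorem seeded_sector_rayleigh_lower_bound (L : ℕ) [NeZero L] (U μ g : ℝ) {β : ℝ} (hβ : 0 ≤ β)
    {N : ℕ} {ψ : Fock (Orb (FermionTorus 2 L))} (hN : IsNParticle N ψ) (hψ : star ψ ⬝ᵥ ψ = 1) :
    β * (μ * N - (star ψ ⬝ᵥ (hubbardTorus 2 L 1 U - ((g / (L : ℝ) ^ 2 : ℝ) : ℂ) •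
        ((pairField dWaveFormFactor L)ᴴ * pairField dWaveFormFactor L)) *ᵥ ψ).re) ≤
      Real.log ((hubbardTorusWith 2 L 1 U μ - ((g / (L : ℝ) ^ 2 : ℝ) : ℂ) •
        ((pairField dWaveFormFactor L)ᴴ * pairField dWaveFormFactor L)).partitionFn β).re := by
  have h := neg_mul_rayleigh_le_log_partitionFn (isHermitian_seededGC L U μ g) hβ ψ hψ
  rw [re_rayleigh_seededGC L U μ g hN hψ] at h
  linarith

/-! ### Template A -/

/-- **Template A.** `TwSeededEnsembleEquivalence → MidpointConvexT0`: average the two sector lower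
bounds for `ψ₁, ψ₂` (`N₁ + N₂ = 2N_L` makes `μ` cancel), then let `β := max 1 (2 log 4/κ)` kill the
entropy allowance. -/
theorem twSeededEnsembleEquivalence_midpointConvexT0 (h : TwSeededEnsembleEquivalence) :
    ∀ δ ∈ Set.Icc (1/10 : ℝ) (2/5 : ℝ), ∃ U₀ : ℝ, 0 < U₀ ∧ ∀ U ∈ Set.Ioc (0 : ℝ) U₀,
      ∀ g ∈ Set.Ioc (0 : ℝ) (1 / 10), ∀ κ : ℝ, 0 < κ → ∃ L₀ : ℕ, ∀ (L : ℕ) [NeZero L], L₀ ≤ L →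
        ∀ (N₁ N₂ : ℕ) (ψ₁ ψ₂ : Fock (Orb (FermionTorus 2 L))), N₁ + N₂ = 2 * (2 * ⌊(1 - δ) * (L : ℝ) ^ 2 / 2⌋₊) →
          IsNParticle N₁ ψ₁ → IsNParticle N₂ ψ₂ → star ψ₁ ⬝ᵥ ψ₁ = 1 → star ψ₂ ⬝ᵥ ψ₂ = 1 →
            (hubbardTorus 2 L 1 U - ((g / (L : ℝ) ^ 2 : ℝ) : ℂ) •
                ((pairField dWaveFormFactor L)ᴴ * pairField dWaveFormFactor L)).minEnergyOn
                (szSector (Λ := FermionTorus 2 L) (2 * ⌊(1 - δ) * (L : ℝ) ^ 2 / 2⌋₊) 0) / (L : ℝ) ^ 2 ≤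
              ((star ψ₁ ⬝ᵥ (hubbardTorus 2 L 1 U - ((g / (L : ℝ) ^ 2 : ℝ) : ℂ) •
                  ((pairField dWaveFormFactor L)ᴴ * pairField dWaveFormFactor L)) *ᵥ ψ₁).re +
                (star ψ₂ ⬝ᵥ (hubbardTorus 2 L 1 U - ((g / (L : ℝ) ^ 2 : ℝ) : ℂ) •
                  ((pairField dWaveFormFactor L)ᴴ * pairField dWaveFormFactor L)) *ᵥ ψ₂).re) /
                (2 * (L : ℝ) ^ 2) + κ := by
  intro δ hδ
  obtain ⟨μ₁, μ₂, -, -, -, U₀, hU₀, hU⟩ := h δ hδ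
  refine ⟨U₀, hU₀, fun U hUm g hg κ hκ => ?_⟩
  -- choose β with log 4 / β ≤ κ / 2 and ε := κ / 2
  set β : ℝ := max 1 (2 * Real.log 4 / κ) with hβdef
  have hβ1 : 1 ≤ β := le_max_left _ _
  have hβpos : 0 < β := lt_of_lt_of_le one_pos hβ1
  have hlog4 : 0 < Real.log 4 := Real.log_pos (by norm_num)
  have hslack : Real.log 4 / β ≤ κ / 2 := by
    rw [div_le_iff₀ hβpos]
    have : 2 * Real.log 4 / κ ≤ β := le_max_right _ _
    rw [div_le_iff₀ hκ] at this
    linarith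
  obtain ⟨μ, -, hμ⟩ := hU U hUm g hg β hβ1
  obtain ⟨L₀, hL₀⟩ := hμ (κ / 2) (by linarith)
  refine ⟨L₀, fun L _ hL N₁ N₂ ψ₁ ψ₂ hsum hN₁ hN₂ hψ₁ hψ₂ => ?_⟩
  have hcrux := hL₀ L hL
  have hLpos : (0 : ℝ) < (L : ℝ) ^ 2 := cast_sq_pos_of_neZero L
  have hβL : 0 < β * (L : ℝ) ^ 2 := mul_pos hβpos hLpos
  -- the two sector lower bounds
  have h1 := seeded_sector_rayleigh_lower_bound L U μ g hβpos.le hN₁ hψ₁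
  have h2 := seeded_sector_rayleigh_lower_bound L U μ g hβpos.le hN₂ hψ₂
  set Z := Real.log ((hubbardTorusWith 2 L 1 U μ - ((g / (L : ℝ) ^ 2 : ℝ) : ℂ) • ((pairField dWaveFormFactor L)ᴴ * pairField dWaveFormFactor L)).partitionFn β).re with hZ
  set E₁ := (star ψ₁ ⬝ᵥ (hubbardTorus 2 L 1 U - ((g / (L : ℝ) ^ 2 : ℝ) : ℂ) • ((pairField dWaveFormFactor L)ᴴ * pairField dWaveFormFactor L)) *ᵥ ψ₁).re
  set E₂ := (star ψ₂ ⬝ᵥ (hubbardTorus 2 L 1 U - ((g / (L : ℝ) ^ 2 : ℝ) : ℂ) • ((pairField dWaveFormFactor L)ᴴ * pairField dWaveFormFactor L)) *ᵥ ψ₂).re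
  set A := (hubbardTorus 2 L 1 U - ((g / (L : ℝ) ^ 2 : ℝ) : ℂ) • ((pairField dWaveFormFactor L)ᴴ * pairField dWaveFormFactor L)).minEnergyOn (szSector (Λ := FermionTorus 2 L) (2 * ⌊(1 - δ) * (L : ℝ) ^ 2 / 2⌋₊) 0)
  have hsumR : (N₁ : ℝ) + N₂ = 2 * (2 * (⌊(1 - δ) * (L : ℝ) ^ 2 / 2⌋₊ : ℝ)) := by exact_mod_cast hsum
  -- averaged bound: β (μ N_L − (E₁+E₂)/2) ≤ Z
  have havg : β * (μ * (2 * (⌊(1 - δ) * (L : ℝ) ^ 2 / 2⌋₊ : ℝ)) - (E₁ + E₂) / 2) ≤ Z := by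
    have : β * (μ * (2 * (⌊(1 - δ) * (L : ℝ) ^ 2 / 2⌋₊ : ℝ)) - (E₁ + E₂) / 2) =
        (β * (μ * N₁ - E₁) + β * (μ * N₂ - E₂)) / 2 := by
      have : (2 * (⌊(1 - δ) * (L : ℝ) ^ 2 / 2⌋₊ : ℝ)) = ((N₁ : ℝ) + N₂) / 2 := by rw [hsumR]; ring
      rw [this]; ring
    rw [this]
    linarith
  -- divide by β L² and combine with the crux instance
  have hdiv : μ * (2 * (⌊(1 - δ) * (L : ℝ) ^ 2 / 2⌋₊ : ℝ)) / (L : ℝ) ^ 2 - (E₁ + E₂) / (2 * (L : ℝ) ^ 2) ≤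
      Z / (β * (L : ℝ) ^ 2) := by
    have key : μ * (2 * (⌊(1 - δ) * (L : ℝ) ^ 2 / 2⌋₊ : ℝ)) - (E₁ + E₂) / 2 ≤ Z / β := by
      rw [le_div_iff₀ hβpos]; linarith [havg]
    have := div_le_div_of_nonneg_right key hLpos.le
    rwa [sub_div, div_div, div_div] at this
  have hc : A / (L : ℝ) ^ 2 + Z / (β * (L : ℝ) ^ 2) - μ * (2 * (⌊(1 - δ) * (L : ℝ) ^ 2 / 2⌋₊ : ℝ)) / (L : ℝ) ^ 2 ≤
      Real.log 4 / β + κ / 2 := by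
    exact hcrux
  linarith

/-- **Template A, kill form.** A T = 0 midpoint-convexity DEFECT of the seeded sector energies at
`N_L` — some `δ` in the window such that for every `U₀` there are admissible `U ≤ U₀`, `g ≤ 1/10`,
a margin `κ > 0` and, for arbitrarily large `L`, unit vectors `ψ₁, ψ₂` in sectors `N₁ + N₂ = 2N_L`
whose mean energy undercuts the `N_L`-sector ground energy by `κ L²` — refutes the crux.
(Phase separation of the SEEDED model across density `1 − δ`; impossible for the pure short-range
model in the limit, so the defect must come from the mean-field seed: size ≤ 64 g per site.) -/
theorem twSeededEnsembleEquivalence_false_of_midpointDefect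
    (hdef : ∃ δ ∈ Set.Icc (1/10 : ℝ) (2/5 : ℝ), ∀ U₀ : ℝ, 0 < U₀ → ∃ U ∈ Set.Ioc (0 : ℝ) U₀,
      ∃ g ∈ Set.Ioc (0 : ℝ) (1 / 10), ∃ κ : ℝ, 0 < κ ∧ ∀ L₀ : ℕ, ∃ (L : ℕ) (_ : NeZero L), L₀ ≤ L ∧
        ∃ (N₁ N₂ : ℕ) (ψ₁ ψ₂ : Fock (Orb (FermionTorus 2 L))), N₁ + N₂ = 2 * (2 * ⌊(1 - δ) * (L : ℝ) ^ 2 / 2⌋₊) ∧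
          IsNParticle N₁ ψ₁ ∧ IsNParticle N₂ ψ₂ ∧ star ψ₁ ⬝ᵥ ψ₁ = 1 ∧ star ψ₂ ⬝ᵥ ψ₂ = 1 ∧
            ((star ψ₁ ⬝ᵥ (hubbardTorus 2 L 1 U - ((g / (L : ℝ) ^ 2 : ℝ) : ℂ) • ((pairField dWaveFormFactor L)ᴴ * pairField dWaveFormFactor L)) *ᵥ ψ₁).re + (star ψ₂ ⬝ᵥ (hubbardTorus 2 L 1 U - ((g / (L : ℝ) ^ 2 : ℝ) : ℂ) • ((pairField dWaveFormFactor L)ᴴ * pairField dWaveFormFactor L)) *ᵥ ψ₂).re) /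
                (2 * (L : ℝ) ^ 2) + κ <
              (hubbardTorus 2 L 1 U - ((g / (L : ℝ) ^ 2 : ℝ) : ℂ) • ((pairField dWaveFormFactor L)ᴴ * pairField dWaveFormFactor L)).minEnergyOn (szSector (Λ := FermionTorus 2 L) (2 * ⌊(1 - δ) * (L : ℝ) ^ 2 / 2⌋₊) 0) / (L : ℝ) ^ 2) :
    ¬ TwSeededEnsembleEquivalence := by
  intro h
  obtain ⟨δ, hδ, hbad⟩ := hdef
  obtain ⟨U₀, hU₀, hgood⟩ := twSeededEnsembleEquivalence_midpointConvexT0 h δ hδ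
  obtain ⟨U, hU, g, hg, κ, hκ, hL⟩ := hbad U₀ hU₀
  obtain ⟨L₀, hL₀⟩ := hgood U hU g hg κ hκ
  obtain ⟨L, hLnz, hLle, N₁, N₂, ψ₁, ψ₂, hsum, hN₁, hN₂, hψ₁, hψ₂, hlt⟩ := hL L₀
  have := hL₀ L hLle N₁ N₂ ψ₁ ψ₂ hsum hN₁ hN₂ hψ₁ hψ₂
  linarith

/-! ### Template B -/

/-- **Template B.** `TwSeededEnsembleEquivalence → SlopeWindowT0` (one sector lower bound, then
`μ ≤ μ₂` resp. `μ₁ ≤ μ` according to the sign of `N_L − N'`, then `β := max 1 (2 log 4/κ)`). -/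
theorem twSeededEnsembleEquivalence_slopeWindowT0 (h : TwSeededEnsembleEquivalence) :
    ∀ δ ∈ Set.Icc (1/10 : ℝ) (2/5 : ℝ), ∃ μ₁ μ₂ : ℝ, -4 < μ₁ ∧ μ₁ ≤ μ₂ ∧ μ₂ < 0 ∧ ∃ U₀ : ℝ, 0 < U₀ ∧
      ∀ U ∈ Set.Ioc (0 : ℝ) U₀, ∀ g ∈ Set.Ioc (0 : ℝ) (1 / 10), ∀ κ : ℝ, 0 < κ → ∃ L₀ : ℕ,
        ∀ (L : ℕ) [NeZero L], L₀ ≤ L → ∀ (N' : ℕ) (ψ' : Fock (Orb (FermionTorus 2 L))),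
          IsNParticle N' ψ' → star ψ' ⬝ᵥ ψ' = 1 →
            (N' ≤ 2 * ⌊(1 - δ) * (L : ℝ) ^ 2 / 2⌋₊ →
              (hubbardTorus 2 L 1 U - ((g / (L : ℝ) ^ 2 : ℝ) : ℂ) •
                  ((pairField dWaveFormFactor L)ᴴ * pairField dWaveFormFactor L)).minEnergyOn
                  (szSector (Λ := FermionTorus 2 L) (2 * ⌊(1 - δ) * (L : ℝ) ^ 2 / 2⌋₊) 0) / (L : ℝ) ^ 2 ≤
                (star ψ' ⬝ᵥ (hubbardTorus 2 L 1 U - ((g / (L : ℝ) ^ 2 : ℝ) : ℂ) •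
                  ((pairField dWaveFormFactor L)ᴴ * pairField dWaveFormFactor L)) *ᵥ ψ').re / (L : ℝ) ^ 2 +
                  μ₂ * ((2 * (⌊(1 - δ) * (L : ℝ) ^ 2 / 2⌋₊ : ℝ)) - N') / (L : ℝ) ^ 2 + κ) ∧
            (2 * ⌊(1 - δ) * (L : ℝ) ^ 2 / 2⌋₊ ≤ N' →
              (hubbardTorus 2 L 1 U - ((g / (L : ℝ) ^ 2 : ℝ) : ℂ) •
                  ((pairField dWaveFormFactor L)ᴴ * pairField dWaveFormFactor L)).minEnergyOn
                  (szSector (Λ := FermionTorus 2 L) (2 * ⌊(1 - δ) * (L : ℝ) ^ 2 / 2⌋₊) 0) / (L : ℝ) ^ 2 ≤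
                (star ψ' ⬝ᵥ (hubbardTorus 2 L 1 U - ((g / (L : ℝ) ^ 2 : ℝ) : ℂ) •
                  ((pairField dWaveFormFactor L)ᴴ * pairField dWaveFormFactor L)) *ᵥ ψ').re / (L : ℝ) ^ 2 +
                  μ₁ * ((2 * (⌊(1 - δ) * (L : ℝ) ^ 2 / 2⌋₊ : ℝ)) - N') / (L : ℝ) ^ 2 + κ) := by
  intro δ hδ
  obtain ⟨μ₁, μ₂, hμ₁, hμ₁₂, hμ₂, U₀, hU₀, hU⟩ := h δ hδ
  refine ⟨μ₁, μ₂, hμ₁, hμ₁₂, hμ₂, U₀, hU₀, fun U hUm g hg κ hκ => ?_⟩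
  set β : ℝ := max 1 (2 * Real.log 4 / κ) with hβdef
  have hβ1 : 1 ≤ β := le_max_left _ _
  have hβpos : 0 < β := lt_of_lt_of_le one_pos hβ1
  have hlog4 : 0 < Real.log 4 := Real.log_pos (by norm_num)
  have hslack : Real.log 4 / β ≤ κ / 2 := by
    rw [div_le_iff₀ hβpos]
    have : 2 * Real.log 4 / κ ≤ β := le_max_right _ _
    rw [div_le_iff₀ hκ] at this
    linarith
  obtain ⟨μ, hμm, hμ⟩ := hU U hUm g hg β hβ1
  obtain ⟨L₀, hL₀⟩ := hμ (κ / 2) (by linarith)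
  refine ⟨L₀, fun L _ hL N' ψ' hN' hψ' => ?_⟩
  have hcrux := hL₀ L hL
  have hLpos : (0 : ℝ) < (L : ℝ) ^ 2 := cast_sq_pos_of_neZero L
  have hβL : 0 < β * (L : ℝ) ^ 2 := mul_pos hβpos hLpos
  have h1 := seeded_sector_rayleigh_lower_bound L U μ g hβpos.le hN' hψ'
  set Z := Real.log ((hubbardTorusWith 2 L 1 U μ - ((g / (L : ℝ) ^ 2 : ℝ) : ℂ) • ((pairField dWaveFormFactor L)ᴴ * pairField dWaveFormFactor L)).partitionFn β).re with hZ
  set E' := (star ψ' ⬝ᵥ (hubbardTorus 2 L 1 U - ((g / (L : ℝ) ^ 2 : ℝ) : ℂ) • ((pairField dWaveFormFactor L)ᴴ * pairField dWaveFormFactor L)) *ᵥ ψ').re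
  set A := (hubbardTorus 2 L 1 U - ((g / (L : ℝ) ^ 2 : ℝ) : ℂ) • ((pairField dWaveFormFactor L)ᴴ * pairField dWaveFormFactor L)).minEnergyOn (szSector (Λ := FermionTorus 2 L) (2 * ⌊(1 - δ) * (L : ℝ) ^ 2 / 2⌋₊) 0)
  -- divide the sector bound by β L²
  have hdiv : (μ * N' - E') / (L : ℝ) ^ 2 ≤ Z / (β * (L : ℝ) ^ 2) := by
    have key : μ * N' - E' ≤ Z / β := by
      rw [le_div_iff₀ hβpos]; linarith [h1]
    have := div_le_div_of_nonneg_right key hLpos.le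
    rwa [div_div] at this
  have hc : A / (L : ℝ) ^ 2 + Z / (β * (L : ℝ) ^ 2) - μ * (2 * (⌊(1 - δ) * (L : ℝ) ^ 2 / 2⌋₊ : ℝ)) / (L : ℝ) ^ 2 ≤
      Real.log 4 / β + κ / 2 := by
    exact hcrux
  -- hence A/L² ≤ E'/L² + μ (N_L − N')/L² + κ
  have hmain : A / (L : ℝ) ^ 2 ≤ E' / (L : ℝ) ^ 2 + μ * ((2 * (⌊(1 - δ) * (L : ℝ) ^ 2 / 2⌋₊ : ℝ)) - N') / (L : ℝ) ^ 2 + κ := by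
    have e1 : (μ * N' - E') / (L : ℝ) ^ 2 = μ * (N' : ℝ) / (L : ℝ) ^ 2 - E' / (L : ℝ) ^ 2 := by
      rw [sub_div]
    have e2 : μ * ((2 * (⌊(1 - δ) * (L : ℝ) ^ 2 / 2⌋₊ : ℝ)) - N') / (L : ℝ) ^ 2 =
        μ * (2 * (⌊(1 - δ) * (L : ℝ) ^ 2 / 2⌋₊ : ℝ)) / (L : ℝ) ^ 2 - μ * (N' : ℝ) / (L : ℝ) ^ 2 := by
      rw [mul_sub, sub_div]
    rw [e1] at hdiv
    rw [e2]
    linarith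
  constructor
  · intro hle
    -- N' ≤ N_L and μ ≤ μ₂: μ (N_L − N') ≤ μ₂ (N_L − N')
    have hnn : (0 : ℝ) ≤ (2 * (⌊(1 - δ) * (L : ℝ) ^ 2 / 2⌋₊ : ℝ)) - N' := by
      have : (N' : ℝ) ≤ (2 * (⌊(1 - δ) * (L : ℝ) ^ 2 / 2⌋₊ : ℝ)) := by exact_mod_cast hle
      linarith
    have hmono : μ * ((2 * (⌊(1 - δ) * (L : ℝ) ^ 2 / 2⌋₊ : ℝ)) - N') / (L : ℝ) ^ 2 ≤ μ₂ * ((2 * (⌊(1 - δ) * (L : ℝ) ^ 2 / 2⌋₊ : ℝ)) - N') / (L : ℝ) ^ 2 :=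
      div_le_div_of_nonneg_right (mul_le_mul_of_nonneg_right hμm.2 hnn) hLpos.le
    linarith
  · intro hle
    have hnp : (2 * (⌊(1 - δ) * (L : ℝ) ^ 2 / 2⌋₊ : ℝ)) - N' ≤ 0 := by
      have : (2 * (⌊(1 - δ) * (L : ℝ) ^ 2 / 2⌋₊ : ℝ)) ≤ (N' : ℝ) := by exact_mod_cast hle
      linarith
    have hmono : μ * ((2 * (⌊(1 - δ) * (L : ℝ) ^ 2 / 2⌋₊ : ℝ)) - N') / (L : ℝ) ^ 2 ≤ μ₁ * ((2 * (⌊(1 - δ) * (L : ℝ) ^ 2 / 2⌋₊ : ℝ)) - N') / (L : ℝ) ^ 2 :=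
      div_le_div_of_nonneg_right (mul_le_mul_of_nonpos_right hμm.1 hnp) hLpos.le
    linarith

end

end Summit.HubbardSuperconductivity.HubbardSuperconductivity.Theorems.TwSeededEnsembleEquivalence.Negative
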